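import Mathlib
import Summits.Ventures.PercRepro2.Defs
import Summits.Ventures.PercRepro2.Harris
import Summits.Ventures.PercRepro2.Graph
import Summits.Ventures.PercRepro2.Events
import Summits.Ventures.PercRepro2.ZCTwoEdge
import Summits.Ventures.PercRepro2.ZCSeries

/-!
# Parallel reduction of the three-event form (T_h) (blind cell PercRepro2, mine-a g46;
MINE-A.md §101.7)

Two parallel edges `f₁`, `f₂` (`ends f₁ = ends f₂`) of weights `p₁`, `p₂` enter every connection
event only through «`f₁` or `f₂` open»: the open graphs of the three states `11`, `10`, `01` agree
(`openGraph_parallel_both`, `openGraph_parallel_snd`), so every cluster event of the root has the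
same probability once `f₁` carries the weight `p₁ + p₂ − p₁ p₂` and `f₂` the weight `0`
(`prob_clusterInEvent_parallel`, by the two-edge pinning `prob_two_pin` and the invariance of the
pinned events `prob_update_eq_of_invariant` of `ZCSeries`).  Hence the (T)-form is the same in the
two weight vectors (`t_expr_parallel`) and (T_h) transfers along the parallel reduction
(`t_of_parallel`).  Together with `TSeries` (series reduction) and the cut-vertex transfers
(`TCutVertex`, `TCutVertexNear`, `TCutVertexHit`), the lane's open instances of (T_h) may be taken
simple, 2-connected between the marks and of minimum degree `≥ 3` off them.  No definition; one seat.
-/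

namespace Summit.Ventures.PercRepro2

namespace TParallel

variable {V : Type*} {E : Type*} [DecidableEq E] {ends : E → Sym2 V} {f₁ f₂ : E}

/-- Opening a second parallel edge does not change the open graph. -/
lemma openGraph_parallel_both (hpar : ends f₁ = ends f₂) (hf : f₁ ≠ f₂) (ω : Config E) :
    openGraph ends (Function.update (Function.update ω f₁ true) f₂ true) =
      openGraph ends (Function.update (Function.update ω f₁ true) f₂ false) := by
  ext u v
  simp only [openGraph_adj, OpenAdj]
  constructor
  · rintro ⟨huv, e, he, hends⟩
    refine ⟨huv, ?_⟩
    by_cases h2 : e = f₂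
    · subst h2
      exact ⟨f₁, by rw [Function.update_of_ne hf, Function.update_self], hpar.trans hends⟩
    · exact ⟨e, by rw [Function.update_of_ne h2] at he ⊢; exact he, hends⟩
  · rintro ⟨huv, e, he, hends⟩
    refine ⟨huv, ?_⟩
    by_cases h2 : e = f₂
    · subst h2
      rw [Function.update_self] at he
      exact absurd he Bool.false_ne_true
    · exact ⟨e, by rw [Function.update_of_ne h2] at he ⊢; exact he, hends⟩

/-- Opening the second parallel edge instead of the first gives the same open graph. -/
lemma openGraph_parallel_snd (hpar : ends f₁ = ends f₂) (hf : f₁ ≠ f₂) (ω : Config E) :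
    openGraph ends (Function.update (Function.update ω f₁ false) f₂ true) =
      openGraph ends (Function.update (Function.update ω f₁ true) f₂ false) := by
  ext u v
  simp only [openGraph_adj, OpenAdj]
  constructor
  · rintro ⟨huv, e, he, hends⟩
    refine ⟨huv, ?_⟩
    by_cases h2 : e = f₂
    · subst h2
      exact ⟨f₁, by rw [Function.update_of_ne hf, Function.update_self], hpar.trans hends⟩
    · by_cases h1 : e = f₁
      · subst h1
        rw [Function.update_of_ne hf, Function.update_self] at he
        exact absurd he Bool.false_ne_true
      · exact ⟨e, by rw [Function.update_of_ne h2, Function.update_of_ne h1] at he ⊢; exact he, hends⟩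
  · rintro ⟨huv, e, he, hends⟩
    refine ⟨huv, ?_⟩
    by_cases h1 : e = f₁
    · subst h1
      exact ⟨f₂, by rw [Function.update_self], hpar.symm.trans hends⟩
    · by_cases h2 : e = f₂
      · subst h2
        rw [Function.update_self] at he
        exact absurd he Bool.false_ne_true
      · exact ⟨e, by rw [Function.update_of_ne h2, Function.update_of_ne h1] at he ⊢; exact he, hends⟩

omit [DecidableEq E] in
/-- Cluster events are determined by the open graph. -/
lemma clusterInEvent_congr_openGraph {ω ω' : Config E} (h : openGraph ends ω = openGraph ends ω')
    (s : V) (𝓔 : Set (Set V)) :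
    ω ∈ clusterInEvent ends s 𝓔 ↔ ω' ∈ clusterInEvent ends s 𝓔 := by
  have hc : cluster ends ω s = cluster ends ω' s := by
    ext u
    simp only [mem_cluster, Conn, h]
  simp only [mem_clusterInEvent, hc]

section Prob

variable [Fintype E] {R : Type*} [CommRing R]

/-- **Parallel reduction, one cluster event**: `P_p(C_s ∈ 𝓔) = P_{p'}(C_s ∈ 𝓔)` with
`p' = p[f₁ ↦ p f₁ + p f₂ − p f₁ · p f₂][f₂ ↦ 0]`. -/
theorem prob_clusterInEvent_parallel (p : E → R) (hpar : ends f₁ = ends f₂) (hf : f₁ ≠ f₂)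
    (s : V) (𝓔 : Set (Set V)) :
    prob p (clusterInEvent ends s 𝓔) =
      prob (Function.update (Function.update p f₁ (p f₁ + p f₂ - p f₁ * p f₂)) f₂ 0)
        (clusterInEvent ends s 𝓔) := by
  set p' := Function.update (Function.update p f₁ (p f₁ + p f₂ - p f₁ * p f₂)) f₂ 0 with hp'
  have e11 : {ω | Function.update (Function.update ω f₁ true) f₂ true ∈ clusterInEvent ends s 𝓔} =
      {ω | Function.update (Function.update ω f₁ true) f₂ false ∈ clusterInEvent ends s 𝓔} := by
    ext ω
    simp only [Set.mem_setOf_eq]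
    exact clusterInEvent_congr_openGraph (openGraph_parallel_both hpar hf ω) s 𝓔
  have e01 : {ω | Function.update (Function.update ω f₁ false) f₂ true ∈ clusterInEvent ends s 𝓔} =
      {ω | Function.update (Function.update ω f₁ true) f₂ false ∈ clusterInEvent ends s 𝓔} := by
    ext ω
    simp only [Set.mem_setOf_eq]
    exact clusterInEvent_congr_openGraph (openGraph_parallel_snd hpar hf ω) s 𝓔
  -- the pinned events are invariant under the states of `f₁`, `f₂`
  have inv : ∀ (b₁ b₂ : Bool) (f : E), (f = f₁ ∨ f = f₂) → ∀ ω b,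
      (Function.update ω f b ∈
          {ω | Function.update (Function.update ω f₁ b₁) f₂ b₂ ∈ clusterInEvent ends s 𝓔} ↔
        ω ∈ {ω | Function.update (Function.update ω f₁ b₁) f₂ b₂ ∈ clusterInEvent ends s 𝓔}) := by
    intro b₁ b₂ f hff ω b
    simp only [Set.mem_setOf_eq]
    rcases hff with rfl | rfl
    · rw [Function.update_idem]
    · rw [Function.update_comm hf.symm, Function.update_idem, ← Function.update_comm hf.symm]
  have hp'1 : p' f₁ = p f₁ + p f₂ - p f₁ * p f₂ := by
    rw [hp', Function.update_of_ne hf, Function.update_self]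
  have hp'2 : p' f₂ = 0 := by rw [hp', Function.update_self]
  rw [prob_two_pin p hf, prob_two_pin p' hf, hp'1, hp'2, e11, e01]
  have inv10 := inv true false
  have inv00 := inv false false
  rw [hp', prob_update_eq_of_invariant _ f₂ 0 (inv10 f₂ (Or.inr rfl)),
    prob_update_eq_of_invariant _ f₁ _ (inv10 f₁ (Or.inl rfl)),
    prob_update_eq_of_invariant _ f₂ 0 (inv00 f₂ (Or.inr rfl)),
    prob_update_eq_of_invariant _ f₁ _ (inv00 f₁ (Or.inl rfl))]
  ring

/-- **Parallel reduction of the (T)-form.** -/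
theorem t_expr_parallel (p : E → R) (hpar : ends f₁ = ends f₂) (hf : f₁ ≠ f₂) (s h : V)
    (𝓤 𝓥 : Set (Set V)) :
    prob p (clusterInEvent ends s {T : Set V | h ∈ T} ∩ clusterInEvent ends s 𝓤 ∩
        clusterInEvent ends s 𝓥) +
      prob p (clusterInEvent ends s {T : Set V | h ∈ T}) *
        prob p (clusterInEvent ends s 𝓤 ∩ clusterInEvent ends s 𝓥) -
      prob p (clusterInEvent ends s {T : Set V | h ∈ T} ∩ clusterInEvent ends s 𝓤) *
        prob p (clusterInEvent ends s 𝓥) -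
      prob p (clusterInEvent ends s {T : Set V | h ∈ T} ∩ clusterInEvent ends s 𝓥) *
        prob p (clusterInEvent ends s 𝓤) =
    prob (Function.update (Function.update p f₁ (p f₁ + p f₂ - p f₁ * p f₂)) f₂ 0)
        (clusterInEvent ends s {T : Set V | h ∈ T} ∩ clusterInEvent ends s 𝓤 ∩
          clusterInEvent ends s 𝓥) +
      prob (Function.update (Function.update p f₁ (p f₁ + p f₂ - p f₁ * p f₂)) f₂ 0)
          (clusterInEvent ends s {T : Set V | h ∈ T}) *
        prob (Function.update (Function.update p f₁ (p f₁ + p f₂ - p f₁ * p f₂)) f₂ 0)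
          (clusterInEvent ends s 𝓤 ∩ clusterInEvent ends s 𝓥) -
      prob (Function.update (Function.update p f₁ (p f₁ + p f₂ - p f₁ * p f₂)) f₂ 0)
          (clusterInEvent ends s {T : Set V | h ∈ T} ∩ clusterInEvent ends s 𝓤) *
        prob (Function.update (Function.update p f₁ (p f₁ + p f₂ - p f₁ * p f₂)) f₂ 0)
          (clusterInEvent ends s 𝓥) -
      prob (Function.update (Function.update p f₁ (p f₁ + p f₂ - p f₁ * p f₂)) f₂ 0)
          (clusterInEvent ends s {T : Set V | h ∈ T} ∩ clusterInEvent ends s 𝓥) *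
        prob (Function.update (Function.update p f₁ (p f₁ + p f₂ - p f₁ * p f₂)) f₂ 0)
          (clusterInEvent ends s 𝓤) := by
  -- intersections of cluster events are cluster events of the intersected up-sets
  have hI : ∀ 𝓐 𝓑 : Set (Set V), clusterInEvent ends s 𝓐 ∩ clusterInEvent ends s 𝓑 =
      clusterInEvent ends s (𝓐 ∩ 𝓑) := by
    intro 𝓐 𝓑
    ext ω
    simp only [Set.mem_inter_iff, mem_clusterInEvent]
  simp only [hI, prob_clusterInEvent_parallel p hpar hf s]

/-- **(T_h) transfers along the parallel reduction.** -/
theorem t_of_parallel {R : Type*} [CommRing R] [LinearOrder R] [IsStrictOrderedRing R]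
    (p : E → R) (hpar : ends f₁ = ends f₂) (hf : f₁ ≠ f₂) (s h : V) (𝓤 𝓥 : Set (Set V))
    (hT : prob (Function.update (Function.update p f₁ (p f₁ + p f₂ - p f₁ * p f₂)) f₂ 0)
            (clusterInEvent ends s {T : Set V | h ∈ T} ∩ clusterInEvent ends s 𝓤) *
          prob (Function.update (Function.update p f₁ (p f₁ + p f₂ - p f₁ * p f₂)) f₂ 0)
            (clusterInEvent ends s 𝓥) +
        prob (Function.update (Function.update p f₁ (p f₁ + p f₂ - p f₁ * p f₂)) f₂ 0)
            (clusterInEvent ends s 𝓤) *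
          prob (Function.update (Function.update p f₁ (p f₁ + p f₂ - p f₁ * p f₂)) f₂ 0)
            (clusterInEvent ends s {T : Set V | h ∈ T} ∩ clusterInEvent ends s 𝓥) ≤
        prob (Function.update (Function.update p f₁ (p f₁ + p f₂ - p f₁ * p f₂)) f₂ 0)
            (clusterInEvent ends s {T : Set V | h ∈ T} ∩ clusterInEvent ends s 𝓤 ∩
              clusterInEvent ends s 𝓥) +
          prob (Function.update (Function.update p f₁ (p f₁ + p f₂ - p f₁ * p f₂)) f₂ 0)
              (clusterInEvent ends s {T : Set V | h ∈ T}) *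
            prob (Function.update (Function.update p f₁ (p f₁ + p f₂ - p f₁ * p f₂)) f₂ 0)
              (clusterInEvent ends s 𝓤 ∩ clusterInEvent ends s 𝓥)) :
    prob p (clusterInEvent ends s {T : Set V | h ∈ T} ∩ clusterInEvent ends s 𝓤) *
        prob p (clusterInEvent ends s 𝓥) +
      prob p (clusterInEvent ends s 𝓤) *
        prob p (clusterInEvent ends s {T : Set V | h ∈ T} ∩ clusterInEvent ends s 𝓥) ≤
      prob p (clusterInEvent ends s {T : Set V | h ∈ T} ∩ clusterInEvent ends s 𝓤 ∩
          clusterInEvent ends s 𝓥) +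
        prob p (clusterInEvent ends s {T : Set V | h ∈ T}) *
          prob p (clusterInEvent ends s 𝓤 ∩ clusterInEvent ends s 𝓥) := by
  have hid := t_expr_parallel p hpar hf s h 𝓤 𝓥
  linarith [hid, hT]

end Prob

end TParallel

end Summit.Ventures.PercRepro2
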